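/-
Copyright (c) 2026 the pub-hodgecm-mathlib formalisation cell (harness21).  Prover seat hodgecm-mathlib-K2E4-p11 (g10) on the S4 valve (dealer K2E2-plan (g8∕g9), S4-R86 (2);
card asked by the (J̃♭-Σ) assembler K2E3-p31 (g3) 03:35:36Z (4); two-hand cut with K2E3-p36 (g4) `R90S4TwistedTubeModelGtLocLetters`), road (J̃♭) MODEL, THE DATUM BRIDGE,
FILE 2∕2: THE HEAD — ★ (M-3b) `twistedTubeJacobianLocal_model` AT `G := G̃_v = GL₃(L ⊗ L⁺_v)`, `K := L_w`, WITH EVERY MODEL LETTER DISCHARGED.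
Crux H413 `stmt-HodgeConjecture-24833`, lane `--supports … --as helper` (count-neutral).  THEOREMS ONLY (no `def`, no `instance`, no notation, no named-fact hypothesis, no `sorry`).
-/
import Summits.HodgeConjecture.HodgeConjecture.Theorems.R90S4TwistedTubeModel               -- ★ p865097 (M-3b, R90-C131-p05): `twistedTubeJacobianLocal_model` (brings ★ (M-3a) p865006, ★ WL2′, ★ DATUM, ★ `exists_depth`)
import Summits.HodgeConjecture.HodgeConjecture.Theorems.R90S4TwistedTubeModelGtLocWeight    -- ★ p865304 FILE 1∕2 (this seat): `eventually_cartanWeight_eq_of_isRegularElt`, `cartanWeight_eq_addEquivAddHaarChar_of_laws`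
import Summits.HodgeConjecture.HodgeConjecture.Theorems.R90S4TwistedTubeModelGtLocLetters   -- ★ (K2E3-p36 (g4)): the 13 one-place letters `gtLocModel_*`, `splitFormPlace_*`, `valuation_galAdicCompletionMap_cm_le`, …
import Summits.HodgeConjecture.HodgeConjecture.Theorems.R90S4EpsOrbitalCanonical            -- ★ `continuous_epsLoc`
import Summits.HodgeConjecture.HodgeConjecture.Theorems.R90S4SplitFormGL                    -- ★ `splitFormGL` (the quasi-split form of record)
import Literature.NumberTheory.Automorphic.QuadraticPlaceDescentPins                          -- ★ `exists_units_galAdicCompletionMap_eq_neg` (a skew unit of `σ_w`)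
import Literature.NumberTheory.Automorphic.AdicCompletionLocalField                           -- ★ instances: `L_w` is a non-archimedean local field (`ValuativeRel`, locally compact)
import Literature.NumberTheory.Automorphic.AdelicSecondCountable                              -- ★ `secondCountableTopology_adicCompletion`
import Literature.NumberTheory.GaloisRepresentations.LocalField                               -- ★ `IsNonarchimedeanLocalField.isLocalField` (Hausdorff)
import HarnessLib

/-!
# R90-TF · S4 (Ch. 13.1–2) · road (J̃♭) MODEL — THE DATUM BRIDGE, FILE 2∕2: `twistedTubeJacobianLocal_model_gtLoc` (★ (M-3b) at `G̃_v`, every model letter discharged)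

Cell `hodgecm-mathlib`, crux H413 (`stmt-HodgeConjecture-24833`, lane `--supports … --as helper`), route of record `HCCMUnconditional` (no route verbs; count-neutral).
Programme R90-TF, section S4 = [Rogawski1990] Ch. 13.1–13.2 (twisted Weyl integration formula; §12.5 p. 186: «the Jacobian at `δ` is `D_G(N δ)²`»); seat K2E4-p11 (g10).
ORDER = S4 dealer S4-R86 (2): the (J̃♭-Σ) assembler K2E3-p31 (g3) (`R90S4TwistedTubeJacobianOfRecord`, Σ-2) consumes THIS head per base point `b₁` of the sheeted transversal,
together with ★ (TJ5-win) p864964's window rows and ★ (TJ6) p865254's Herbrand row, inside ★ Σ-1 p865316 `twistedTubeJacobian_of_rows`.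

THE POINT.  ★ (M-3b) `R90S4TwistedTubeModel.twistedTubeJacobianLocal_model` (R90-C131-p05) proves the local ε-twisted tube-Jacobian socket «W-LOC» in a one-place
MODEL `ρ : G ≃ GL_m(K)` from 26 model letters (`ρ σ J ε γ T b₀ D` and their laws).  This file DISCHARGES THEM at the datum of record:
`G := GtLoc L v = GL₃(L ⊗_{L⁺} L⁺_v)`, `K := L_w` for the ONE place `w ∣ v` above a non-split `v` (`c̄ • w = w`), `m := 3`,
* `ρ` ANY monoid hom `G̃_v →* GL₃(L_w)` reading matrices entrywise through the evaluation `π_w` (`hρπ`; the one-place model `localGLPiEquiv ≫ localGLPiEvalEquiv` of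
  ★ SING-ε satisfies it by `rfl`) — inducing, injective, surjective (★ LETTERS (1)–(3));
* `σ := σ_w = galAdicCompletionMap c̄` (continuous ★, involution ★, valuation-preserving ★ LETTERS (4)); `J := J_w = splitForm.map (algebraMap L L_w)` (invertible, `σ_w`-hermitian,
  `J`, `J⁻¹ = J` integral: ★ LETTERS (5)–(10)); `ε := ε_v = epsLoc L Φ₃ v` with `ρ(ε g) = J⁻¹ ((ρ g)⁻¹.map σ_w)ᵀ J` (★ LETTERS (11)) and continuous (★ `continuous_epsLoc`);
* `γ := ρ γ₀` for a regular `γ₀ ∈ U(Φ₃)(L⁺_v)` (separable at `w`: ★ LETTERS (12)), `T := A = Cent_{G̃_v}(γ₀)` (`hT`: ★ LETTERS (13)) closed;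
* the base point: ANY `b₀ ∈ A` with `N b₀ = b₀ ε(b₀)` regular — `ε b₀ ∈ A` (★ `epsLoc_mem_centralizer_coe`), `b₀ ε(b₀) = ε(b₀) b₀` (★ `mul_comm_of_mem_centralizer_of_isRegularElt`);
* the weight `D := fun b => cartanWeight L v T (φ b)` for a continuous norm homomorphism `φ : A →* T ≤ U(Φ₃)(L⁺_v)` (`(φ b).val = N b`): locally constant at `b₀` and equal at `b₀`
  to the modulus of EVERY twisted linear part at `N b₀` — ★ FILE 1∕2 `eventually_cartanWeight_eq_of_isRegularElt`, `cartanWeight_eq_addEquivAddHaarChar_of_laws` (★ (TJ3) dock,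
  skew unit ★ `exists_units_galAdicCompletionMap_eq_neg`).
CONCLUSION = ★ (M-3b)'s ∃-export VERBATIM (ORDER ≡ ★ p865097 :98–:122): chart objects `α Λ c σV pM pT Λ′ Ξ k` with the letters ★ (TJ5-win) shares, the twist-window letter, and
«W-LOC» at `b₀` for ANY left-invariant inversion-invariant s-finite `τA` on `A` finite on compacts and positive on opens, with `m₀ = quotientMeasure A τA _ νGt (π c(Λ′ k))` and
the weight `cartanWeight L v T ∘ φ` under the integral.  No measure on `M₃(L_w)` enters the statement (a local Borel structure is chosen in the proof).

HONEST LABEL: HC_CM is proved only modulo the 7 printed citations (2 remaining named inputs: hLiu418 = `stmt-HodgeConjecture-24832`, h413 = `stmt-HodgeConjecture-24833`)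
until rung 0 closes; this head discharges the MODEL letters of the `hloc` row only — the (J̃♭) socket is paid at K2E3-p31's Σ-2 call, and (J̃♭)∕(W-NP) stay OPEN until then
(REL ≠ ★ ≠ BUILT; count-neutral).

## References
* [Rogawski1990] J. D. Rogawski, *Automorphic Representations of Unitary Groups in Three Variables*, Ann. of Math. Stud. 123 (1990), §12.5 pp. 182, 186; §4.10 p. 57; §4.9 p. 54.
* [HarishChandra1970] Harish-Chandra (notes by G. van Dijk), *Harmonic Analysis on Reductive p-adic Groups*, LNM 162 (1970), Part V §4 Lemma 22. Context locator.
* [Labesse1999] J.-P. Labesse, *Cohomologie, stabilisation et changement de base*, Astérisque 257 (1999), §III.1 (twisted orbital integrals, the norm). Context locator.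
* [PlatonovRapinchuk1994] V. Platonov, A. Rapinchuk, *Algebraic Groups and Number Theory* (1994), §3.3 (Cayley chart, congruence filtrations). Context locator.
* [CasselsFrohlichANT1967] J. W. S. Cassels, A. Fröhlich (eds.), *Algebraic Number Theory* (1967), Ch. II §10 (completion at one place). Context locator.
-/

set_option autoImplicit false
-- the mandated namespace repeats the single-problem summit's segment (`HodgeConjecture.HodgeConjecture`)
set_option linter.dupNamespace false

open Set Filter MeasureTheory MeasureTheory.Measure TopologicalSpace Topology Matrix Polynomial ValuativeRel
open NumberField IsDedekindDomain
open Literature.NumberTheory.Automorphic Literature.NumberTheory.Automorphic.UnitaryGroup Literature.NumberTheory.Rogawski1990 Literature.NumberTheory.Rogawski1990.Ch4Sec10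
open Literature.NumberTheory.GaloisRepresentations Literature.NumberTheory.GaloisRepresentations.IsNonarchimedeanLocalField
open Literature.MeasureTheory.Group Literature.MeasureTheory.Measure Literature.NumberTheory.Weil1982.UnitaryFinTopForm
open Summit.HodgeConjecture.HodgeConjecture.Cruxes.H413
open Summit.HodgeConjecture.HodgeConjecture.Cruxes.H413.F0P3cStCharTSCayleyChartHaar
open Summit.HodgeConjecture.HodgeConjecture.Cruxes.H413.F0P3InnerFormClassificationV6 (splitForm)
open scoped ENNReal NNReal MatrixGroups

namespace Summit.HodgeConjecture.HodgeConjecture.R90.S4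


section Head

variable (L : Type) [Field L] [NumberField L] [IsCMField L] (v : HeightOneSpectrum (𝓞 ↥(maximalRealSubfield L)))
  (w : PlacesOver L v)

/-- **THE LOCAL ε-TWISTED TUBE-JACOBIAN SOCKET («W-LOC») AT EVERY BASE POINT OF A CENTRALISER TORUS OF `G̃_v` — ★ (M-3b) AT THE DATUM, EVERY MODEL LETTER DISCHARGED.**
`v` non-split (`hns`), `w ∣ v` the place, `ρ : G̃_v →* GL₃(L_w)` reading matrices through `π_w` (`hρπ`), `γ₀ ∈ U(Φ₃)(L⁺_v)` regular, `A = Cent_{G̃_v}(γ₀)` closed, `φ : A →* T` a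
continuous norm homomorphism into a subgroup `T ≤ U(Φ₃)(L⁺_v)` (`(φ b).val = N b = b ε(b)`), `νGt` a Haar measure on `G̃_v` (right invariant), `τA` ANY left-invariant
inversion-invariant s-finite measure on `A` finite on compacts and positive on opens, `Ψ (x, b) = x b ε(x)⁻¹`, and a base point `b₀ ∈ A` with `N b₀` regular.  Conclusion: ★ (M-3b)'s
∃-export verbatim — chart objects `α Λ c σV pM pT Λ′ Ξ k` over `M₃(L_w)` with the ★ (TJ5-win) letters and the twist-window letter `ε(c X) ∈ c(Λ_j)`, and an open `U ∋ b₀` in `A` with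
`M₀ = c(pM Λ′ₖ)` Borel, `m₀ = quotientMeasure A τA _ νGt (π c(Λ′ₖ))` positive finite, `Ψ` injective on `M₀ × U`, and `νGt (Ψ '' (M₀ ×ˢ V′)) = m₀ · ∫⁻_{V′} cartanWeight T (φ b) dτA` for
every Borel `V′ ⊆ U`.  Proof: ★ (M-3b) fed the 13 one-place ★ LETTERS, ★ `continuous_epsLoc`, ★ `epsLoc_mem_centralizer_coe`, ★ `mul_comm_of_mem_centralizer_of_isRegularElt`, and
★ FILE 1∕2's weight letters (`hDlc` after `rw [hφ]`; `hDval` with a skew unit of `σ_w`).  «`dδ̃ = D_G(N δ)² dδ` locally on the twisted tube.»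
[cite: Rogawski1990, §12.5 p. 186; §4.10 p. 57] [cite: HarishChandra1970, Lemma 22] [cite: Labesse1999, §III.1] [cite: PlatonovRapinchuk1994, §3.3] -/
theorem twistedTubeJacobianLocal_model_gtLoc (hns : ∀ w : PlacesOver L v, IsCMField.complexConj L • w.1 = w.1)
    [LocallyCompactSpace (GtLoc L v)] [SecondCountableTopology (GtLoc L v)] [T2Space (GtLoc L v)]
    [MeasurableSpace (GtLoc L v)] [BorelSpace (GtLoc L v)]
    (ρ : GtLoc L v →* GL (Fin 3) (w.1.adicCompletion L))
    (hρπ : ∀ δ : GtLoc L v, ((ρ δ : GL (Fin 3) (w.1.adicCompletion L)) : Matrix (Fin 3) (Fin 3) (w.1.adicCompletion L)) =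
      δ.val.map (Pi.evalRingHom (fun w' : PlacesOver L v => w'.1.adicCompletion L) w))
    {γ₀ : Gqs L v} (hγ₀ : IsRegularElt (γ₀.val : GtLoc L v)) (T : Subgroup (Gqs L v))
    {A : Subgroup (GtLoc L v)} (hAγ : A = Subgroup.centralizer ({(γ₀.val : GtLoc L v)} : Set (GtLoc L v))) (hAcl : IsClosed (A : Set (GtLoc L v)))
    (φ : ↥A →* ↥T) (hφ : ∀ b : ↥A, (((φ b : ↥T) : Gqs L v).val : GtLoc L v) = epsNorm (epsLoc L (splitFormGL L) v) (b : GtLoc L v))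
    (hφc : Continuous φ)
    [MeasurableSpace (GtLoc L v ⧸ A)] [BorelSpace (GtLoc L v ⧸ A)]
    (νGt : Measure (GtLoc L v)) [νGt.IsHaarMeasure] [νGt.IsMulRightInvariant]
    (τA : Measure ↥A) [τA.IsMulLeftInvariant] [IsFiniteMeasureOnCompacts τA] [τA.IsOpenPosMeasure] [τA.IsInvInvariant] [SFinite τA]
    (Ψ : GtLoc L v × ↥A → GtLoc L v) (hΨ : ∀ (x : GtLoc L v) (b : ↥A), Ψ (x, b) = x * b * (epsLoc L (splitFormGL L) v x)⁻¹)
    (b₀ : GtLoc L v) (hb₀ : b₀ ∈ A) (hreg : IsRegularElt (epsNorm (epsLoc L (splitFormGL L) v) b₀)) :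
    ∃ (α : ValueGroupWithZero (w.1.adicCompletion L)) (Λ : ℕ → AddSubgroup (Matrix (Fin 3) (Fin 3) (w.1.adicCompletion L)))
      (c : Matrix (Fin 3) (Fin 3) (w.1.adicCompletion L) → GtLoc L v)
      (σV : Matrix (Fin 3) (Fin 3) (w.1.adicCompletion L) → Matrix (Fin 3) (Fin 3) (w.1.adicCompletion L) → Matrix (Fin 3) (Fin 3) (w.1.adicCompletion L))
      (pM pT : Matrix (Fin 3) (Fin 3) (w.1.adicCompletion L) →+ Matrix (Fin 3) (Fin 3) (w.1.adicCompletion L))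
      (Λ' : ℕ → AddSubgroup (Matrix (Fin 3) (Fin 3) (w.1.adicCompletion L)))
      (Ξ : Matrix (Fin 3) (Fin 3) (w.1.adicCompletion L) → Matrix (Fin 3) (Fin 3) (w.1.adicCompletion L)) (k : ℕ),
      α ≠ 0 ∧ α < 1 ∧
      (∀ j X, X ∈ Λ j ↔ ValBound (α ^ (j + 1)) X) ∧
      (∀ X ∈ Λ 0, ((ρ (c X) : GL (Fin 3) (w.1.adicCompletion L)) : Matrix (Fin 3) (Fin 3) (w.1.adicCompletion L)) = cayley X) ∧
      ContinuousOn c (Λ 0 : Set (Matrix (Fin 3) (Fin 3) (w.1.adicCompletion L))) ∧ IsOpen (c '' (Λ 0 : Set (Matrix (Fin 3) (Fin 3) (w.1.adicCompletion L)))) ∧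
      (∀ W ∈ Λ 0, ∀ X ∈ Λ 0, σV W X = (1 - W)⁻¹ * (W + X) * (1 + W * X)⁻¹ * (1 - W)) ∧
      (∀ W ∈ Λ 0, ContinuousOn (σV W) (Λ 0 : Set (Matrix (Fin 3) (Fin 3) (w.1.adicCompletion L)))) ∧
      (∀ j Z, Z ∈ Λ' j ↔ (pM Z ∈ Λ j ∧ pT Z ∈ Λ j)) ∧ (∀ Z, pM Z + pT Z = Z) ∧ (∀ Z, pM (pM Z) = pM Z) ∧ Continuous pM ∧ Continuous pT ∧
      (∀ j, ∀ Z ∈ Λ (j + k), pM Z ∈ Λ j ∧ pT Z ∈ Λ j) ∧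
      (∀ Z, Ξ Z = (1 - pM Z)⁻¹ * (pM Z + pT Z) * (1 + pM Z * pT Z)⁻¹ * (1 - pM Z)) ∧
      (∀ Y ∈ Λ 0, pM Y = 0 → c Y ∈ A) ∧ (∀ W ∈ Λ 0, c W ∈ A → pM W = 0) ∧
      (∀ j, ∀ X ∈ Λ j, epsLoc L (splitFormGL L) v (c X) ∈ c '' (Λ j : Set (Matrix (Fin 3) (Fin 3) (w.1.adicCompletion L)))) ∧
      ∃ U : Set ↥A, IsOpen U ∧ (⟨b₀, hb₀⟩ : ↥A) ∈ U ∧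
        MeasurableSet (c '' (pM '' (Λ' k : Set (Matrix (Fin 3) (Fin 3) (w.1.adicCompletion L))))) ∧
        quotientMeasure A τA hAcl νGt ((QuotientGroup.mk : GtLoc L v → GtLoc L v ⧸ A) '' (c '' (Λ' k : Set (Matrix (Fin 3) (Fin 3) (w.1.adicCompletion L))))) ≠ 0 ∧
        quotientMeasure A τA hAcl νGt ((QuotientGroup.mk : GtLoc L v → GtLoc L v ⧸ A) '' (c '' (Λ' k : Set (Matrix (Fin 3) (Fin 3) (w.1.adicCompletion L))))) ≠ ⊤ ∧
        InjOn Ψ ((c '' (pM '' (Λ' k : Set (Matrix (Fin 3) (Fin 3) (w.1.adicCompletion L))))) ×ˢ U) ∧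
        ∀ V' : Set ↥A, MeasurableSet V' → V' ⊆ U →
          νGt (Ψ '' ((c '' (pM '' (Λ' k : Set (Matrix (Fin 3) (Fin 3) (w.1.adicCompletion L))))) ×ˢ V')) =
            quotientMeasure A τA hAcl νGt ((QuotientGroup.mk : GtLoc L v → GtLoc L v ⧸ A) '' (c '' (Λ' k : Set (Matrix (Fin 3) (Fin 3) (w.1.adicCompletion L))))) *
              ∫⁻ b in V', (cartanWeight L v T (φ b) : ℝ≥0∞) ∂τA := by
  classical
  have hw : IsCMField.complexConj L • w.1 = w.1 := hns w
  -- ### instances at `K = L_w` and on `M₃(L_w)` (the conclusion is matrix-measure-free, so a local Borel structure is legitimate)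
  haveI : T2Space (w.1.adicCompletion L) := (IsNonarchimedeanLocalField.isLocalField (w.1.adicCompletion L)).toT2Space
  haveI : SecondCountableTopology (w.1.adicCompletion L) := secondCountableTopology_adicCompletion L w.1
  haveI : CharZero (w.1.adicCompletion L) := charZero_of_injective_algebraMap (algebraMap L (w.1.adicCompletion L)).injective
  letI : MeasurableSpace (Matrix (Fin 3) (Fin 3) (w.1.adicCompletion L)) := borel _
  haveI : BorelSpace (Matrix (Fin 3) (Fin 3) (w.1.adicCompletion L)) := ⟨rfl⟩
  haveI : LocallyCompactSpace (Matrix (Fin 3) (Fin 3) (w.1.adicCompletion L)) :=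
    inferInstanceAs (LocallyCompactSpace (Fin 3 → Fin 3 → w.1.adicCompletion L))
  haveI : Algebra.IsQuadraticExtension ↥(maximalRealSubfield L) L := IsCMField.isQuadraticExtension L
  -- ### the one-place letters (K2E3-p36 (g4) `R90S4TwistedTubeModelGtLocLetters`)
  have hρ := gtLocModel_isInducing L v w hw ρ hρπ
  have hρinj := gtLocModel_injective L v w hw ρ hρπ
  have hρsurj := gtLocModel_surjective L v w hw ρ hρπ
  have hσc := continuous_galAdicCompletionMap L (IsCMField.complexConj L) hw
  have hσ2 : ∀ a, galAdicCompletionMap (L := L) (IsCMField.complexConj L) hw (galAdicCompletionMap (L := L) (IsCMField.complexConj L) hw a) = a :=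
    fun a => galAdicCompletionMap_galAdicCompletionMap_of_smul_eq (IsCMField.complexConj L) w (IsCMField.complexConj_ne_one L) hw a
  have hσv := valuation_galAdicCompletionMap_cm_le L v w hw
  have hJ := isUnit_det_splitFormPlace L v w
  have hJh := splitFormPlace_map_transpose L v w hw
  have hJ1 := valBound_one_splitFormPlace L v w
  have hJi1 := valBound_one_splitFormPlace_inv L v w
  have hερ := gtLocModel_epsLoc L v w hw ρ hρπ
  have hεc : Continuous (epsLoc L (splitFormGL L) v) := continuous_epsLoc L (splitFormGL L) v
  have hγsep := gtLocModel_separable_charpoly L v w ρ hρπ hγ₀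
  have hT : ∀ g : GtLoc L v, g ∈ A ↔ ρ g * ρ (γ₀.val : GtLoc L v) = ρ (γ₀.val : GtLoc L v) * ρ g := fun g => by
    rw [hAγ]; exact gtLocModel_mem_centralizer_iff L v w hw ρ hρπ _ g
  -- ### the base point: `ε b₀ ∈ A`, `b₀ ε(b₀) = ε(b₀) b₀`, `N b₀` regular at `w`
  have hb₀' : b₀ ∈ Subgroup.centralizer ({(γ₀.val : GtLoc L v)} : Set (GtLoc L v)) := hAγ ▸ hb₀
  have hεb₀' : epsLoc L (splitFormGL L) v b₀ ∈ Subgroup.centralizer ({(γ₀.val : GtLoc L v)} : Set (GtLoc L v)) := epsLoc_mem_centralizer_coe (Φ := splitFormGL L) γ₀ hb₀'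
  have hεb₀ : epsLoc L (splitFormGL L) v b₀ ∈ A := hAγ ▸ hεb₀'
  have hcomm : b₀ * epsLoc L (splitFormGL L) v b₀ = epsLoc L (splitFormGL L) v b₀ * b₀ := mul_comm_of_mem_centralizer_of_isRegularElt hγ₀ hb₀' hεb₀'
  have hsep : (((ρ (b₀ * epsLoc L (splitFormGL L) v b₀) : GL (Fin 3) (w.1.adicCompletion L)) : Matrix (Fin 3) (Fin 3) (w.1.adicCompletion L))).charpoly.Separable :=
    gtLocModel_separable_charpoly L v w ρ hρπ hreg
  -- ### the weight letters (FILE 1/2)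
  have hDlc : ∀ᶠ b in 𝓝 (⟨b₀, hb₀⟩ : ↥A), cartanWeight L v T (φ b) = cartanWeight L v T (φ ⟨b₀, hb₀⟩) := by
    have hreg' : IsRegularElt ((((φ ⟨b₀, hb₀⟩ : ↥T) : Gqs L v).val : GtLoc L v)) := by rw [hφ]; exact hreg
    exact (hφc.tendsto _).eventually (eventually_cartanWeight_eq_of_isRegularElt L v hns T (φ ⟨b₀, hb₀⟩) hreg')
  obtain ⟨θu, hθu⟩ := exists_units_galAdicCompletionMap_eq_neg (IsCMField.complexConj L) (IsCMField.complexConj_ne_one L) v w hw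
  have hN : ((ρ (b₀ * epsLoc L (splitFormGL L) v b₀) : GL (Fin 3) (w.1.adicCompletion L)) : Matrix (Fin 3) (Fin 3) (w.1.adicCompletion L)) =
      ((ρ b₀ : GL (Fin 3) (w.1.adicCompletion L)) : Matrix (Fin 3) (Fin 3) (w.1.adicCompletion L)) *
        (((splitForm L 3).map (algebraMap L (w.1.adicCompletion L)))⁻¹ *
          ((((ρ b₀)⁻¹ : GL (Fin 3) (w.1.adicCompletion L)) : Matrix (Fin 3) (Fin 3) (w.1.adicCompletion L)).map
            (galAdicCompletionMap (L := L) (IsCMField.complexConj L) hw))ᵀ *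
          (splitForm L 3).map (algebraMap L (w.1.adicCompletion L))) := by
    rw [map_mul, Units.val_mul, hερ]
  have hcommM : ((ρ b₀ : GL (Fin 3) (w.1.adicCompletion L)) : Matrix (Fin 3) (Fin 3) (w.1.adicCompletion L)) *
        (((splitForm L 3).map (algebraMap L (w.1.adicCompletion L)))⁻¹ *
          ((((ρ b₀)⁻¹ : GL (Fin 3) (w.1.adicCompletion L)) : Matrix (Fin 3) (Fin 3) (w.1.adicCompletion L)).map
            (galAdicCompletionMap (L := L) (IsCMField.complexConj L) hw))ᵀ *
          (splitForm L 3).map (algebraMap L (w.1.adicCompletion L))) =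
      (((splitForm L 3).map (algebraMap L (w.1.adicCompletion L)))⁻¹ *
          ((((ρ b₀)⁻¹ : GL (Fin 3) (w.1.adicCompletion L)) : Matrix (Fin 3) (Fin 3) (w.1.adicCompletion L)).map
            (galAdicCompletionMap (L := L) (IsCMField.complexConj L) hw))ᵀ *
          (splitForm L 3).map (algebraMap L (w.1.adicCompletion L))) *
        ((ρ b₀ : GL (Fin 3) (w.1.adicCompletion L)) : Matrix (Fin 3) (Fin 3) (w.1.adicCompletion L)) := by
    rw [← hερ, ← Units.val_mul, ← map_mul, hcomm, map_mul, Units.val_mul]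
  have hDval := fun (LE : Matrix (Fin 3) (Fin 3) (w.1.adicCompletion L) ≃ₜ+ Matrix (Fin 3) (Fin 3) (w.1.adicCompletion L)) hLz hLm =>
    cartanWeight_eq_addEquivAddHaarChar_of_laws L v w hw hns θu.ne_zero hθu _ hJ hJh ρ hρπ b₀ (b₀ * epsLoc L (splitFormGL L) v b₀) hN hcommM hsep T
      (φ ⟨b₀, hb₀⟩) (hφ _) LE hLz hLm
  exact twistedTubeJacobianLocal_model ρ hρ hρinj hρsurj (galAdicCompletionMap (L := L) (IsCMField.complexConj L) hw) hσc hσ2 hσv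
    ((splitForm L 3).map (algebraMap L (w.1.adicCompletion L))) hJ hJh hJ1 hJi1 (epsLoc L (splitFormGL L) v) hερ hεc hγsep hT hAcl νGt τA Ψ hΨ
    b₀ hb₀ hεb₀ hcomm hsep (fun b => cartanWeight L v T (φ b)) hDlc hDval

end Head

end Summit.HodgeConjecture.HodgeConjecture.R90.S4
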